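import Mathlib
import Summits.ValiantsHypothesis.ValiantsHypothesis.Theorems.KPlusLogSqLawWeakLiftingTowerGraftSkewBlockCrossings

/-!
# Tower graft line — THE BIDIAGONAL SKEW-BLOCK FAMILY: `2m` phantoms with rootless digits, every size (kernel), three letters

Calibration file for the line `Cruxes/WeakLifting/Lines/tower_graft.lean` (crux `WeakLifting` = stmt-ValiantsHypothesis-19561; S4b; crit-6 kill-shape
#38⁺).  NO stub is claimed.  Feeds EXPLICIT rational data of every size to `skewBlock_phantoms_square` (`…SkewBlockCrossings`, p689545):
`B(t)` upper bidiagonal of size `q + 1` on the support `(1, 5, 21)`, superdiagonal `t`, diagonal trinomials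
`α_r t + β_r t⁵ + t²¹ = t (t⁴ − (2r+1)⁴)(t⁴ − (2r+2)⁴)·(t¹² + ⋯) ` (`trinomial_factor`, cofactor positive), so `det B` (= the product of the
diagonal, `det_bidiag`) vanishes exactly at `t = 1, 2, …, 2q+2` and not at the half-integers, and `B` minus column `0` is injective
(`mulVec_injective_bidiag_minor`: its top square block is lower triangular with diagonal `t`).  Hence (`skewBlock_phantoms_bidiag`):
**for every `q`, some `η > 0` gives a symmetric three-letter skew-block pencil of size `m = 2(q+1)` whose corner graft (corner exponent
`42(q+1)+1`) has at least `4(q+1) = 2m` distinct positive roots while BOTH digits have none** — so no corner law whose overhead is a function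
of `K` alone (`Z₊(h) ≤ Z₊(A) + Z₊(E) + f(K)`) survives on general supports, for any `f` (take `K = 3`, `m > f(3)/2`); kill template #38 covered
`f` = constant.  SCOPE (honest): the support `(1,5,21)` is FIXED, so it is an `m`-tower only for `m ≤ 4` (the `(4,3)` tower datum is
`…SkewBlockInstanceFourThree`); the tower-respecting version for every `m` needs the support `(1, m+1, (m+1)²)` and the general trinomial division
`u^n + βu + α = (u−a)(u−b)·Σ hᵢ(a,b)u^{n−2−i}` — not in this file.  The `Θ(m²)` count (Descartes-rich `B`) stays LOCATED (`exp/skewblock_k3.py`).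
HONEST FRAMING: explicit algebra + the kernel mechanism of p689545; fixed support; nothing on S4/S4b/S5/S5ᴸ, TowerB, `WeakLifting`, Conjecture B,
`MatrixDescartes` (18050) or `VP ≠ VNP`.  Def-free.  Seat: prover val-sym-lift-p2 g19, `--supports stmt-ValiantsHypothesis-19561`.
-/

-- `Summit.ValiantsHypothesis.ValiantsHypothesis.…` repeats a component by the D-0017 layout
-- (single-conjunct summit), which the `dupNamespace` linter flags; the name is mandated.
set_option linter.dupNamespace false

namespace Summit.ValiantsHypothesis.ValiantsHypothesis.Theorems.KPlusLogSqLaw.TowerGraft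

open Polynomial Matrix
open scoped BigOperators Polynomial

section Bidiagonal

/-- the trinomial `α t + β t⁵ + t²¹` with `α = ab(a+b)(a²+b²)`, `β = −(a⁴+a³b+a²b²+ab³+b⁴)` factors as
`t (t⁴ − a)(t⁴ − b)(t¹² + (a+b) t⁸ + (a²+ab+b²) t⁴ + (a+b)(a²+b²))`. [folklore] -/
theorem trinomial_factor (a b t : ℝ) :
    a * b * (a + b) * (a ^ 2 + b ^ 2) * t + -(a ^ 4 + a ^ 3 * b + a ^ 2 * b ^ 2 + a * b ^ 3 + b ^ 4) * t ^ 5 + t ^ 21 =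
      t * (t ^ 4 - a) * (t ^ 4 - b) * (t ^ 12 + (a + b) * t ^ 8 + (a ^ 2 + a * b + b ^ 2) * t ^ 4 + (a + b) * (a ^ 2 + b ^ 2)) := by
  ring

/-- the last factor is positive for `a, b ≥ 0`, `t` real. [folklore] -/
theorem trinomial_cofactor_pos {a b : ℝ} (ha : 0 < a) (hb : 0 < b) (t : ℝ) :
    0 < t ^ 12 + (a + b) * t ^ 8 + (a ^ 2 + a * b + b ^ 2) * t ^ 4 + (a + b) * (a ^ 2 + b ^ 2) := by
  have h1 : 0 ≤ t ^ 12 := by positivity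
  have h2 : 0 ≤ (a + b) * t ^ 8 := by positivity
  have h3 : 0 ≤ (a ^ 2 + a * b + b ^ 2) * t ^ 4 := by positivity
  have h4 : 0 < (a + b) * (a ^ 2 + b ^ 2) := by positivity
  linarith

/-! ### Generic bidiagonal matrices -/

/-- an upper bidiagonal matrix has determinant the product of its diagonal. [folklore] -/
theorem det_bidiag {q : ℕ} (δ : Fin (q + 1) → ℝ) (t : ℝ) :
    (Matrix.of fun r c : Fin (q + 1) => if c = r then δ r else if (c : ℕ) = r + 1 then t else 0).det = ∏ r, δ r := by
  rw [Matrix.det_of_upperTriangular]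
  · exact Finset.prod_congr rfl fun r _ => by simp
  · intro i j hij
    have h1 : ¬ j = i := fun h => by simp [h] at hij
    have h2 : ¬ ((j : ℕ) = i + 1) := by
      intro h; have : (j : ℕ) < i := hij; omega
    simp [h1, h2]

/-- deleting column `0` of an upper bidiagonal matrix with superdiagonal `t ≠ 0` leaves an injective map: its top `q × q` block is lower
triangular with diagonal `t`. [folklore] -/
theorem mulVec_injective_bidiag_minor {q : ℕ} (δ : Fin (q + 1) → ℝ) {t : ℝ} (ht : t ≠ 0) :
    Function.Injective ((Matrix.of fun r c : Fin (q + 1) => if c = r then δ r else if (c : ℕ) = r + 1 then t else 0).submatrix id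
      (0 : Fin (q + 1)).succAbove).mulVec := by
  set M : Matrix (Fin (q + 1)) (Fin (q + 1)) ℝ :=
    Matrix.of fun r c : Fin (q + 1) => if c = r then δ r else if (c : ℕ) = r + 1 then t else 0 with hM
  set U : Matrix (Fin q) (Fin q) ℝ := (M.submatrix id (0 : Fin (q + 1)).succAbove).submatrix Fin.castSucc id with hU
  have hUapply : ∀ r c : Fin q, U r c = if c = r then t else if (c : ℕ) < r then M (Fin.castSucc r) (Fin.succ c) else 0 := by
    intro r c
    simp only [hU, hM, Matrix.submatrix_apply, id, Fin.succAbove_zero, Matrix.of_apply]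
    by_cases hcr : c = r
    · subst hcr
      have h1 : ¬ (Fin.succ c = Fin.castSucc c) := fun h => by
        have := congrArg Fin.val h; simp at this
      simp [h1]
    · by_cases hlt : (c : ℕ) < r
      · simp [hcr, hlt]
      · have h2 : ¬ (Fin.succ c = Fin.castSucc r) := fun h => by
          have := congrArg Fin.val h; simp at this; omega
        have h4 : ¬ ((c : ℕ) = r) := fun h => hcr (Fin.ext h)
        simp [hcr, hlt, h2, h4]
  have hdiag : ∀ r : Fin q, U r r = t := fun r => by rw [hUapply]; simp
  have hUdet : U.det = t ^ q := by
    rw [Matrix.det_of_lowerTriangular U ?_]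
    · simp [hdiag, Finset.prod_const]
    · intro i j hij
      have hij' : i < j := hij
      rw [hUapply]
      have h1 : ¬ j = i := fun h => by rw [h] at hij'; exact lt_irrefl _ hij'
      have h2 : ¬ ((j : ℕ) < i) := fun h => by
        have : (i : ℕ) < j := hij'; omega
      simp [h1, h2]
  have hUne : U.det ≠ 0 := by rw [hUdet]; exact pow_ne_zero _ ht
  intro x y hxy
  have hsub : (M.submatrix id (0 : Fin (q + 1)).succAbove).mulVec (x - y) = 0 := by
    rw [Matrix.mulVec_sub]; exact sub_eq_zero.mpr hxy
  have hU0 : U.mulVec (x - y) = 0 := by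
    funext r
    have := congrFun hsub (Fin.castSucc r)
    simpa [hU, Matrix.mulVec, dotProduct, Matrix.submatrix_apply] using this
  exact sub_eq_zero.mp (Matrix.eq_zero_of_mulVec_eq_zero hUne hU0)

/-- a half-integer is not a natural number (in `ℝ`). [folklore] -/
theorem nat_add_half_ne_nat (n m : ℕ) : (n : ℝ) + 1 / 2 ≠ (m : ℝ) := by
  intro h
  have h2 : ((2 * n + 1 : ℕ) : ℝ) = ((2 * m : ℕ) : ℝ) := by push_cast; linarith
  have h3 := Nat.cast_injective (R := ℝ) h2
  omega

/-- `(n + 1/2)⁴ ≠ m⁴` for naturals `n, m`. [folklore] -/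
theorem nat_add_half_pow_four_ne (n m : ℕ) : ((n : ℝ) + 1 / 2) ^ 4 ≠ ((m : ℕ) : ℝ) ^ 4 := by
  intro h
  have h1 : (0 : ℝ) ≤ (n : ℝ) + 1 / 2 := by positivity
  have h2 : (0 : ℝ) ≤ (m : ℝ) := by positivity
  exact nat_add_half_ne_nat n m ((pow_left_inj₀ h1 h2 (by norm_num)).mp h)


/-! ### The bidiagonal family: `4(q+1) = 2m` phantoms with rootless digits, every size -/

/-- **THE BIDIAGONAL SKEW-BLOCK FAMILY (kernel, every size).**  For every `q` there are three-letter blocks `B : Fin 3 → Matrix (Fin (q+1)) (Fin (q+1)) ℝ`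
on the genuine `2(q+1)`-tower `d = (1, 5, 21)` and an `η > 0` such that the skew-block pencil `G_η` of size `m = 2(q+1)` has a corner graft at the
tower-top exponent `D = 42(q+1) + 1` with **at least `4(q+1) = 2m` distinct positive roots while BOTH digits `det G_η`, `det (G_η)_{jj}` have none**.
Blocks: `B(t)` upper bidiagonal with superdiagonal `t` and diagonal trinomials `t(t⁴ − (2r+1)⁴)(t⁴ − (2r+2)⁴)·(positive)` (roots exactly
`2r+1, 2r+2`), fed to `skewBlock_phantoms_square` with `ρ_n = n + 1`, `τ_n = n + ½`. [this work] -/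
theorem skewBlock_phantoms_bidiag (q : ℕ) :
    ∃ (B : Fin 3 → Matrix (Fin (q + 1)) (Fin (q + 1)) ℝ) (η : ℝ), 0 < η ∧
      ((∑ l, (X : ℝ[X]) ^ (![1, 5, 21] : Fin 3 → ℕ) l • (Matrix.fromBlocks (if l = 0 then η • (1 : Matrix (Fin (q + 1)) (Fin (q + 1)) ℝ) else 0)
        (B l) (B l)ᵀ (if l = 0 then -(η • (1 : Matrix (Fin (q + 1)) (Fin (q + 1)) ℝ)) else 0)).map C).det.roots.toFinset.filter
        (fun t => 0 < t)).card = 0 ∧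
      (((∑ l, (X : ℝ[X]) ^ (![1, 5, 21] : Fin 3 → ℕ) l • (Matrix.fromBlocks (if l = 0 then η • (1 : Matrix (Fin (q + 1)) (Fin (q + 1)) ℝ) else 0)
        (B l) (B l)ᵀ (if l = 0 then -(η • (1 : Matrix (Fin (q + 1)) (Fin (q + 1)) ℝ)) else 0)).map C).submatrix
        (Sum.map id (0 : Fin (q + 1)).succAbove) (Sum.map id (0 : Fin (q + 1)).succAbove)).det.roots.toFinset.filter
        (fun t => 0 < t)).card = 0 ∧
      4 * (q + 1) ≤ ((((∑ l, (X : ℝ[X]) ^ (![1, 5, 21] : Fin 3 → ℕ) l •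
          (Matrix.fromBlocks (if l = 0 then η • (1 : Matrix (Fin (q + 1)) (Fin (q + 1)) ℝ) else 0) (B l) (B l)ᵀ
          (if l = 0 then -(η • (1 : Matrix (Fin (q + 1)) (Fin (q + 1)) ℝ)) else 0)).map C) +
        (X : ℝ[X]) ^ (42 * (q + 1) + 1) • Matrix.single (Sum.inr 0 : Fin (q + 1) ⊕ Fin (q + 1)) (Sum.inr 0) (1 : ℝ[X])).det).roots.toFinset.filter
        (fun t => 0 < t)).card := by
  -- block root data
  set a : Fin (q + 1) → ℝ := fun r => ((2 * (r : ℕ) + 1 : ℕ) : ℝ) ^ 4 with ha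
  set b : Fin (q + 1) → ℝ := fun r => ((2 * (r : ℕ) + 2 : ℕ) : ℝ) ^ 4 with hb
  have ha0 : ∀ r, 0 < a r := fun r => by simp only [ha]; positivity
  have hb0 : ∀ r, 0 < b r := fun r => by simp only [hb]; positivity
  set α : Fin (q + 1) → ℝ := fun r => a r * b r * (a r + b r) * (a r ^ 2 + b r ^ 2) with hα
  set β : Fin (q + 1) → ℝ := fun r => -(a r ^ 4 + a r ^ 3 * b r + a r ^ 2 * b r ^ 2 + a r * b r ^ 3 + b r ^ 4) with hβ
  -- the letters
  set B : Fin 3 → Matrix (Fin (q + 1)) (Fin (q + 1)) ℝ :=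
    ![Matrix.of (fun r c : Fin (q + 1) => if c = r then α r else if (c : ℕ) = r + 1 then (1 : ℝ) else 0),
      Matrix.diagonal β, (1 : Matrix (Fin (q + 1)) (Fin (q + 1)) ℝ)] with hB
  -- the real `B`-pencil is upper bidiagonal with trinomial diagonal and superdiagonal `t`
  set δ : ℝ → Fin (q + 1) → ℝ := fun t r => α r * t + β r * t ^ 5 + t ^ 21 with hδ
  have hBt : ∀ t : ℝ, (∑ l, t ^ (![1, 5, 21] : Fin 3 → ℕ) l • B l) =
      Matrix.of (fun r c : Fin (q + 1) => if c = r then δ t r else if (c : ℕ) = r + 1 then t else 0) := by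
    intro t
    ext r c
    rw [Matrix.sum_apply, Fin.sum_univ_three]
    simp only [hB, hδ, Matrix.smul_apply, Matrix.cons_val_zero, Matrix.cons_val_one, Matrix.head_cons, Matrix.cons_val_two,
      Matrix.tail_cons, Matrix.of_apply, Matrix.diagonal_apply, Matrix.one_apply, smul_eq_mul]
    by_cases h1 : c = r
    · subst h1; simp; ring
    · have h2 : ¬ r = c := fun h => h1 h.symm
      by_cases h3 : (c : ℕ) = r + 1
      · simp [h1, h2, h3]
      · simp [h1, h2, h3]
  have hδfac : ∀ t r, δ t r = t * (t ^ 4 - a r) * (t ^ 4 - b r) *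
      (t ^ 12 + (a r + b r) * t ^ 8 + (a r ^ 2 + a r * b r + b r ^ 2) * t ^ 4 + (a r + b r) * (a r ^ 2 + b r ^ 2)) := by
    intro t r; simp only [hδ, hα, hβ]; exact trinomial_factor (a r) (b r) t
  have hdet : ∀ t : ℝ, (∑ l, t ^ (![1, 5, 21] : Fin 3 → ℕ) l • B l).det = ∏ r, δ t r := fun t => by rw [hBt, det_bidiag]
  refine ⟨B, ?_⟩
  obtain ⟨η, hη, h1, h2, h3⟩ := skewBlock_phantoms_square (![1, 5, 21] : Fin 3 → ℕ) 0 (42 * (q + 1) + 1) B 0 (2 * (q + 1))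
    (fun n => (n : ℝ) + 1 / 2) (fun n => (n : ℝ) + 1) (fun n => by simp; norm_num) (fun n => by push_cast; linarith)
    (fun n => by positivity)
    (fun n hn => by
      -- `det B(n + ½) ≠ 0`: every diagonal trinomial is non-zero off the integers
      rw [hdet]
      refine Finset.prod_ne_zero_iff.mpr fun r _ => ?_
      rw [hδfac]
      have hτ : (0 : ℝ) < (n : ℝ) + 1 / 2 := by positivity
      refine mul_ne_zero (mul_ne_zero (mul_ne_zero hτ.ne' (sub_ne_zero.mpr ?_)) (sub_ne_zero.mpr ?_))
        (trinomial_cofactor_pos (ha0 r) (hb0 r) _).ne'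
      · simp only [ha]; exact nat_add_half_pow_four_ne n _
      · simp only [hb]; exact nat_add_half_pow_four_ne n _)
    (fun n hn => by
      -- `det B(n + 1) = 0`: the diagonal trinomial of block `n / 2` vanishes
      rw [hdet]
      refine Finset.prod_eq_zero (Finset.mem_univ (⟨n / 2, by omega⟩ : Fin (q + 1))) ?_
      rw [hδfac]
      rcases Nat.even_or_odd n with ⟨k, hk⟩ | ⟨k, hk⟩
      · have e1 : (n / 2 : ℕ) = k := by omega
        have e2 : ((n : ℝ) + 1) ^ 4 - a ⟨n / 2, by omega⟩ = 0 := by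
          simp only [ha, e1]; push_cast; rw [hk]; push_cast; ring
        rw [e2]; ring
      · have e1 : (n / 2 : ℕ) = k := by omega
        have e2 : ((n : ℝ) + 1) ^ 4 - b ⟨n / 2, by omega⟩ = 0 := by
          simp only [hb, e1]; push_cast; rw [hk]; push_cast; ring
        rw [e2]; ring)
    (fun n hn => by
      -- `B″(n + 1)` has full column rank: the deleted column is column `0`, the superdiagonal is `n + 1 ≠ 0`
      rw [hBt]
      have hinj := mulVec_injective_bidiag_minor (δ ((n : ℝ) + 1)) (show ((n : ℝ) + 1) ≠ 0 by positivity)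
      have hpd := Matrix.PosDef.conjTranspose_mul_self _ hinj
      rw [Matrix.conjTranspose_eq_transpose_of_trivial] at hpd
      exact hpd.det_pos.ne')
  exact ⟨η, hη, h1, h2, by simpa [mul_comm, mul_assoc, mul_left_comm] using h3⟩

end Bidiagonal

end Summit.ValiantsHypothesis.ValiantsHypothesis.Theorems.KPlusLogSqLaw.TowerGraft
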